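import Summits.BirchSwinnertonDyer.Rank1Residual.Additive.QuadraticBranchMinusLFunctionUnique
import Summits.BirchSwinnertonDyer.Rank1Residual.Additive.QuadraticBranchPAdicGrossZagierValuation
import HarnessLib

/-!
# Route `InertBadSignedBranches` (rung K8), crux `CccOneLawOnTypeIstarZero` (stmt-19223): in the
# tree's vocabulary a `p`-adic Gross–Zagier VALUE law for the leading coefficient of Kobayashi's
# `L_p⁻(V, η, X)` COLLAPSES to its valuation — the VALUATION law C-cc-1 is the complete invariant
# (helper toward stmt-BirchSwinnertonDyer-19223; cell bsd-cm, seat bsd-cm-k8i-c2 g3; nothing asserted)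

Context (tribunal-bsd STATUS 2026-08-26T04:45–04:51Z, director RULING 04:47:22Z): T1 records for
this route the chip `t1′:conjunct-restatement` — the attacked crux C-cc-1
(`CccOneLawOnTypeIstarZero`: `coeff₁ L ≠ 0 ∧ v_p(coeff₁ L) = 2ν + ord_p(L′(W,1)/(Ω_W·Reg W))` for
every admissible `L`) is equivalent to `BSD_p` on the type modulo its own cite-level support
(`CccOneLowerHalf.cccOneLawOnTypeIstarZero_iff_bsdpOnType`) — and recommends the re-cut "C-ii": the
`p`-adic Gross–Zagier VALUE formula as the attacked crux. THIS FILE records, in the kernel, what such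
a re-cut can and cannot be over the tree's present object for `L_p⁻(V, η, X)`:

the predicate `Additive.IsQuadraticBranchMinusLFunction f p ϖ L` (cc-typer-6 / x1b; flag
`Kob03-Lminus-eta-upto-unit`) pins `L` by Kobayashi's interpolation property (3.5)+(3.7) UP TO A UNIT
`u ∈ ℤ_p^×` (the unit is existentially quantified inside the predicate). Hence

* §1 `isQuadraticBranchMinusLFunction_units_smul` — the admissible `L` form a full `ℤ_p^×`-ORBIT:
  if `L` is admissible so is `v • L` for every `v ∈ ℤ_p^×` (the converse, "two admissible `L` differ
  by a unit", is x1b's `IsQuadraticBranchMinusLFunction.exists_units_smul_eq`);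
* §2 `exists_units_mul_eq_of_norm_eq` — two non-zero `p`-adic integers of the same norm differ by a
  unit (the valuation spheres of `ℤ_p ∖ {0}` are exactly the `ℤ_p^×`-orbits);
* §3 **`forall_coeff_one_iff_forall_sphere`** — for ANY predicate `Φ` on `ℤ_p` ("a law for the
  leading coefficient"), `Φ (coeff₁ L)` holds for every admissible `L` IFF `Φ` holds on the whole
  valuation sphere `{c ≠ 0, ‖c‖ = ‖coeff₁ L₀‖}` of one admissible `L₀` with `coeff₁ L₀ ≠ 0`: every
  law for `coeff₁ L_p⁻(V, η, X)` expressible over this object is a law about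
  (`coeff₁ ≠ 0` and) `v_p(coeff₁)` ONLY — which is what C-cc-1 states;
* §3 **`not_forall_coeff_one_eq`** — in particular a FIXED-VALUE law `∀ admissible L, coeff₁ L = c`
  (`c ≠ 0`) is FALSE as soon as one admissible `L` exists (`L` and `(−1) • L` are both admissible).

READING for the planner / tribunal (no item is filed here, D-0014): a crux "the `p`-adic
Gross–Zagier VALUE identity for `coeff₁ L_p⁻(V, η, X)`" typed over `IsQuadraticBranchMinusLFunction`
is either unit-invariant — then it is EQUIVALENT to the valuation law C-cc-1 (§3, first theorem) —
or not — then it is refutable (§3, second theorem). A VALUE crux genuinely STRONGER than 19223 needs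
a NEW typed object first: Kobayashi's `L_p⁻(V, η, X)` with the unit pinned (the period / Gauss-sum
normalisation of (3.5) made explicit, retiring flag `Kob03-Lminus-eta-upto-unit`) together with the
Dieudonné pairing `[ω_V, φω_V]` and a sign (x1b GEN 29 AMENDMENT 1, option (C-ii) "deferred: waits
for those objects", module docstring of `Additive/QuadraticBranchPAdicGrossZagierValuation.lean`).
That is a typing (CONSTRUCTION-interface) task, like T-K7r-OBJ for K7r; it is not this file.

HONEST LABEL: theorems only (no `def`, no named fact, no axiom beyond the standard three); nothing
booked; no label moves; 19223, the leaf K8 and O10 stay OPEN; BSD is not proved by any of this.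
[cite: Kobayashi2003, Thm. 3.2, (3.5) and (3.7) (p. 7)] [cite: Pollack2003, Prop. 6.9 (proof) and §3]
-/

set_option autoImplicit false
set_option linter.dupNamespace false

noncomputable section

open scoped Classical MatrixGroups ModularForm

open CongruenceSubgroup WeierstrassCurve
open Literature.NumberTheory.EllipticCurves
open Literature.NumberTheory.EllipticCurves.ModularForms
open Literature.NumberTheory.EllipticCurves.Kobayashi2003
open Summit.BirchSwinnertonDyer.Rank1Residual.Additive

namespace Summit.BirchSwinnertonDyer.BirchSwinnertonDyer.Theorems.CccOneValueCollapse

variable {p : ℕ} [hp : Fact p.Prime]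

/-! ## §1 The admissible `L` form a full `ℤ_p^×`-orbit -/

/-- **Rescaling by a unit preserves Kobayashi's quadratic-branch interpolation property**: if
`IsQuadraticBranchMinusLFunction f p ϖ L` then `IsQuadraticBranchMinusLFunction f p ϖ (v • L)` for
every `v ∈ ℤ_p^×` (the unit `u` of (3.5) becomes `v·u`; (3.7) is homogeneous). Together with x1b's
`exists_units_smul_eq` the admissible `L` are exactly one `ℤ_p^×`-orbit.
[cite: Kobayashi2003, Thm. 3.2, (3.5) and (3.7) (p. 7)] -/
theorem isQuadraticBranchMinusLFunction_units_smul {N : ℕ} {f : CuspForm (Gamma0 N) 2} {ϖ : ℚ}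
    {L : IwasawaAlgebra p} (h : IsQuadraticBranchMinusLFunction f p ϖ L) (v : ℤ_[p]ˣ) :
    IsQuadraticBranchMinusLFunction f p ϖ ((v : ℤ_[p]) • L) := by
  obtain ⟨h0, u, H⟩ := h
  refine ⟨?_, v * u, ?_⟩
  · rw [← PowerSeries.coeff_zero_eq_constantCoeff_apply, PowerSeries.coeff_smul,
      PowerSeries.coeff_zero_eq_constantCoeff_apply, h0, smul_zero]
  · intro n hn ψ hψ
    set ι : ℤ_[p] →+* ℂ_[p] := (algebraMap ℚ_[p] ℂ_[p]).comp (algebraMap ℤ_[p] ℚ_[p]) with hι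
    have hs := (H n hn ψ hψ).mul_left (ι (v : ℤ_[p]))
    have hfun : (fun k : ℕ ↦ ι (PowerSeries.coeff k ((v : ℤ_[p]) • L)) *
        (ψ (cyclotomicGenerator p : ZMod (p ^ (n + 1))) - 1) ^ k) =
        fun k : ℕ ↦ ι (v : ℤ_[p]) * (ι (PowerSeries.coeff k L) *
          (ψ (cyclotomicGenerator p : ZMod (p ^ (n + 1))) - 1) ^ k) := by
      funext k
      rw [PowerSeries.coeff_smul, smul_eq_mul, map_mul, mul_assoc]
    have hval : (-1 : ℂ_[p]) ^ ((n + 1) / 2) *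
          algebraMap ℚ_[p] ℂ_[p] ((((v * u : ℤ_[p]ˣ) : ℤ_[p]) : ℚ_[p]) * (ϖ : ℚ_[p])) *
          (if Even (p / 2) then ratTwistedSymbolSum f ψ else ratMinusTwistedSymbolSum f ψ) /
        (cyclotomicOmegaPlus p n).eval₂ (algebraMap ℤ ℂ_[p])
          (ψ (cyclotomicGenerator p : ZMod (p ^ (n + 1))) - 1) =
        ι (v : ℤ_[p]) * ((-1 : ℂ_[p]) ^ ((n + 1) / 2) *
          algebraMap ℚ_[p] ℂ_[p] (((u : ℤ_[p]) : ℚ_[p]) * (ϖ : ℚ_[p])) *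
          (if Even (p / 2) then ratTwistedSymbolSum f ψ else ratMinusTwistedSymbolSum f ψ) /
        (cyclotomicOmegaPlus p n).eval₂ (algebraMap ℤ ℂ_[p])
          (ψ (cyclotomicGenerator p : ZMod (p ^ (n + 1))) - 1)) := by
      have hvu : algebraMap ℚ_[p] ℂ_[p] ((((v * u : ℤ_[p]ˣ) : ℤ_[p]) : ℚ_[p]) * (ϖ : ℚ_[p])) =
          ι (v : ℤ_[p]) * algebraMap ℚ_[p] ℂ_[p] (((u : ℤ_[p]) : ℚ_[p]) * (ϖ : ℚ_[p])) := by
        rw [Units.val_mul, PadicInt.coe_mul, mul_assoc, map_mul, hι, RingHom.comp_apply,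
          PadicInt.algebraMap_apply]
      rw [hvu]
      ring
    rw [hfun, hval]
    exact hs

/-! ## §2 Valuation spheres of `ℤ_p ∖ {0}` are `ℤ_p^×`-orbits -/

omit hp in
/-- Two non-zero `p`-adic integers of the same norm differ by a unit of `ℤ_p`. [folklore] -/
theorem exists_units_mul_eq_of_norm_eq [Fact p.Prime] {c₀ c : ℤ_[p]} (hc₀ : c₀ ≠ 0)
    (hn : ‖c‖ = ‖c₀‖) : ∃ v : ℤ_[p]ˣ, c = (v : ℤ_[p]) * c₀ := by
  have hc₀' : (c₀ : ℚ_[p]) ≠ 0 := fun h ↦ hc₀ (PadicInt.coe_eq_zero.mp h)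
  have hn0 : ‖(c₀ : ℚ_[p])‖ ≠ 0 := norm_ne_zero_iff.mpr hc₀'
  -- the quotient `c / c₀ ∈ ℚ_p` has norm one, hence is a unit of `ℤ_p`
  set w : ℚ_[p] := (c : ℚ_[p]) / (c₀ : ℚ_[p]) with hw
  have hw1 : ‖w‖ = 1 := by
    rw [hw, norm_div, ← PadicInt.norm_def, ← PadicInt.norm_def, hn, div_self]
    rwa [PadicInt.norm_def]
  let w' : ℤ_[p] := ⟨w, hw1.le⟩
  have hw' : IsUnit w' := PadicInt.isUnit_iff.mpr (by rw [PadicInt.norm_def]; exact hw1)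
  refine ⟨hw'.unit, ?_⟩
  apply Subtype.coe_injective
  show (c : ℚ_[p]) = ((hw'.unit : ℤ_[p]) : ℚ_[p]) * (c₀ : ℚ_[p])
  rw [IsUnit.unit_spec]
  show (c : ℚ_[p]) = w * (c₀ : ℚ_[p])
  rw [hw, div_mul_cancel₀ _ hc₀']

/-! ## §3 Every law for `coeff₁ L_p⁻(V, η, X)` over the tree's object is a law about its valuation -/

/-- **VALUE COLLAPSES TO VALUATION.** Let `L₀` be admissible (`IsQuadraticBranchMinusLFunction f p ϖ
L₀`, `p` odd) with `coeff₁ L₀ ≠ 0`. For EVERY predicate `Φ` on `ℤ_p`: `Φ (coeff₁ L)` holds for all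
admissible `L` if and only if `Φ c` holds for every non-zero `c` with `‖c‖ = ‖coeff₁ L₀‖`. So a law
for the leading coefficient of Kobayashi's `L_p⁻(V, η, X)` that is expressible over the tree's
predicate carries exactly the information "`coeff₁ ≠ 0` and `v_p(coeff₁) = m`" — the content of the
crux C-cc-1 — and no VALUE identity beyond it. (→: x1b's uniqueness up to a unit; ←: §1 + §2.)
[cite: Kobayashi2003, Thm. 3.2, (3.5) and (3.7) (p. 7)] [cite: Pollack2003, Prop. 6.9 (proof) and §3] -/
theorem forall_coeff_one_iff_forall_sphere (hp2 : p ≠ 2) {N : ℕ} {f : CuspForm (Gamma0 N) 2}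
    {ϖ : ℚ} {L₀ : IwasawaAlgebra p} (h₀ : IsQuadraticBranchMinusLFunction f p ϖ L₀)
    (hc₀ : PowerSeries.coeff 1 L₀ ≠ 0) (Φ : ℤ_[p] → Prop) :
    (∀ L : IwasawaAlgebra p, IsQuadraticBranchMinusLFunction f p ϖ L → Φ (PowerSeries.coeff 1 L)) ↔
      ∀ c : ℤ_[p], c ≠ 0 → ‖c‖ = ‖PowerSeries.coeff 1 L₀‖ → Φ c := by
  constructor
  · intro hΦ c _ hn
    obtain ⟨v, hv⟩ := exists_units_mul_eq_of_norm_eq hc₀ hn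
    have h := hΦ _ (isQuadraticBranchMinusLFunction_units_smul h₀ v)
    rwa [PowerSeries.coeff_smul, smul_eq_mul, ← hv] at h
  · intro hΦ L hL
    obtain ⟨v, hv⟩ := h₀.coeff_one_eq_units_mul hp2 hL
    refine hΦ _ ?_ ?_
    · rw [hv]
      exact mul_ne_zero (Units.ne_zero v) hc₀
    · rw [hv, norm_mul, PadicInt.norm_units, one_mul]

/-- **A FIXED-VALUE law is refutable.** If one admissible `L₀` exists, then for every `c ≠ 0` the
statement "`coeff₁ L = c` for all admissible `L`" is FALSE (`L₀` and `(−1) • L₀` are both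
admissible and `ℤ_p` has characteristic zero). So a `p`-adic Gross–Zagier VALUE crux typed over
`IsQuadraticBranchMinusLFunction` with a prescribed value is not a candidate statement; only its
unit-invariant shadow (the valuation law) is. [cite: Kobayashi2003, Thm. 3.2, (3.5) and (3.7) (p. 7)] -/
theorem not_forall_coeff_one_eq {N : ℕ} {f : CuspForm (Gamma0 N) 2} {ϖ : ℚ} {L₀ : IwasawaAlgebra p}
    (h₀ : IsQuadraticBranchMinusLFunction f p ϖ L₀) {c : ℤ_[p]} (hc : c ≠ 0) :
    ¬ ∀ L : IwasawaAlgebra p, IsQuadraticBranchMinusLFunction f p ϖ L → PowerSeries.coeff 1 L = c := by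
  intro hall
  have h1 := hall L₀ h₀
  have h2 := hall _ (isQuadraticBranchMinusLFunction_units_smul h₀ (-1))
  rw [PowerSeries.coeff_smul, smul_eq_mul, Units.val_neg, Units.val_one, neg_one_mul, h1] at h2
  -- `-c = c` forces `c = 0`
  have h3 : (2 : ℤ_[p]) * c = 0 := by
    rw [two_mul]
    nth_rewrite 1 [← h2]
    exact neg_add_cancel c
  rcases mul_eq_zero.mp h3 with h | h
  · exact two_ne_zero h
  · exact hc h

/-- **Applied to the crux's own shape.** C-cc-1 (`Additive.QuadraticBranchPAdicGrossZagierValuationAt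
W p`) quantifies over ALL admissible `L` of each datum and concludes `coeff₁ L ≠ 0 ∧ v(coeff₁ L) = m`
— a unit-invariant predicate, as it must be by `forall_coeff_one_iff_forall_sphere`. Recorded here in
the form: under C-cc-1, at every datum the admissible leading coefficients are confined to ONE
valuation sphere, and EVERY point of that sphere is the leading coefficient of some admissible `L`
(so nothing finer than the sphere is determined by the data). Bookkeeping; nothing booked.
[cite: Kobayashi2003, Thm. 3.2, (3.5) and (3.7) (p. 7)] -/
theorem exists_admissible_coeff_one_eq_iff_mem_sphere (hp2 : p ≠ 2) {N : ℕ} {f : CuspForm (Gamma0 N) 2} {ϖ : ℚ}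
    {L₀ : IwasawaAlgebra p} (h₀ : IsQuadraticBranchMinusLFunction f p ϖ L₀)
    (hc₀ : PowerSeries.coeff 1 L₀ ≠ 0) (c : ℤ_[p]) :
    (∃ L : IwasawaAlgebra p, IsQuadraticBranchMinusLFunction f p ϖ L ∧ PowerSeries.coeff 1 L = c) ↔
      c ≠ 0 ∧ ‖c‖ = ‖PowerSeries.coeff 1 L₀‖ := by
  constructor
  · rintro ⟨L, hL, rfl⟩
    obtain ⟨v, hv⟩ := h₀.coeff_one_eq_units_mul hp2 hL
    rw [hv, norm_mul, PadicInt.norm_units, one_mul]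
    exact ⟨mul_ne_zero (Units.ne_zero v) hc₀, rfl⟩
  · rintro ⟨-, hn⟩
    obtain ⟨v, hv⟩ := exists_units_mul_eq_of_norm_eq hc₀ hn
    exact ⟨_, isQuadraticBranchMinusLFunction_units_smul h₀ v,
      by rw [PowerSeries.coeff_smul, smul_eq_mul, hv]⟩

end Summit.BirchSwinnertonDyer.BirchSwinnertonDyer.Theorems.CccOneValueCollapse

end
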